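import Summits.Ventures.QEC.Census.CSSNormalFormSAT.EncodeSound
import Summits.Ventures.QEC.Census.CSSNormalFormSAT.EncodeSoundLex
import HarnessLib

/-!
# Soundness of the explicit-index encoding, part 2: the lex family and the whole CNF (KERNEL-PLAN item 2)

The `q`-th lex chain of `NFEnc.symClauses c` compares the pair `lexPair c q` of variable lists (rows `i, i+1` reversed for `q < b−1`;
columns `j+1, j` of `S` and of `S^c` after). With the auxiliaries valued `evalAux c P q k := [the first k compared bits agree]` the lex
family is satisfied under `LexCond c P` (each compared pair is `lexLE` on the bits of `P`), and together with part 1: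
`satisfies_cnf : ZCond → XCond → LexCond → (valOf (assignP c P)).satisfies_fmla (NFEnc.fmla c)` — the model that contradicts the
kernel UNSAT theorems `unsat_nf16_b<b>_w<w>`. [folklore]
-/

set_option autoImplicit false

namespace Summit.Ventures.QEC.Census.CSSNormalFormSAT

open NFEnc

/-- The pair of variable lists compared by the `q`-th lex chain (same enumeration as `symClauses`). (definition) -/
def lexPair (c : Cfg) (q : ℕ) : List ℤ × List ℤ :=
  if q < c.b - 1 then
    ((((List.range c.m).reverse).map fun j => c.pv q j), (((List.range c.m).reverse).map fun j => c.pv (q + 1) j))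
  else if q < c.b - 1 + (c.w - 1) then
    let j := q - (c.b - 1)
    (((List.range c.b).map fun i => c.pv i (j + 1)), ((List.range c.b).map fun i => c.pv i j))
  else
    let j := c.w + (q - (c.b - 1) - (c.w - 1))
    (((List.range c.b).map fun i => c.pv i (j + 1)), ((List.range c.b).map fun i => c.pv i j))

/-- The compared bit lists of the `q`-th chain under `P`. (definition) -/
def lexBits (c : Cfg) (P : ℕ → ℕ → Bool) (q : ℕ) : List Bool × List Bool :=
  (((lexPair c q).1.map fun v => pbit c P v.toNat), ((lexPair c q).2.map fun v => pbit c P v.toNat))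

/-- Boolean test «the first `k` entries agree». (definition) -/
def prefixEqB (xs ys : List Bool) (k : ℕ) : Bool := (List.range k).all fun i => xs.getD i false == ys.getD i false

/-- `prefixEqB` computes `prefixEq`. [folklore] -/
theorem prefixEqB_eq_true_iff (xs ys : List Bool) (k : ℕ) : prefixEqB xs ys k = true ↔ prefixEq xs ys k := by
  simp [prefixEqB, prefixEq, List.all_eq_true]

/-- Intended value of the lex auxiliary `ev q k`: the first `k` compared bits agree. (definition) -/
def evalAux (c : Cfg) (P : ℕ → ℕ → Bool) (q k : ℕ) : Bool :=
  prefixEqB (lexBits c P q).1 (lexBits c P q).2 k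

/-- The full assignment determined by `P`. (definition) -/
def assignP (c : Cfg) (P : ℕ → ℕ → Bool) : ℕ → Bool := assign c P (evalAux c P)

/-- The lex condition: every compared pair is lexicographically ordered on the bits of `P`. (definition) -/
def LexCond (c : Cfg) (P : ℕ → ℕ → Bool) : Prop :=
  ∀ q, q < c.NQ → lexLE (lexBits c P q).1 (lexBits c P q).2

section
variable (c : Cfg) (P : ℕ → ℕ → Bool)

/-- Decoding of a lex auxiliary: `assign (ev q k) = evalAux q k` (`k < L`). [folklore] -/
theorem assignP_ev {q k : ℕ} (hk : k < c.L) : assignP c P (c.ev q k).toNat = evalAux c P q k := by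
  have hL : 0 < c.L := by omega
  have h1 : (c.ev q k).toNat = 1 + c.b * c.m + c.NZ * c.m + c.NX * c.b + q * c.L + k := rfl
  have hgt1 : ¬ 1 + c.b * c.m + c.NZ * c.m + c.NX * c.b + q * c.L + k ≤ c.b * c.m := by omega
  have hgt2 : ¬ 1 + c.b * c.m + c.NZ * c.m + c.NX * c.b + q * c.L + k ≤ c.b * c.m + c.NZ * c.m := by omega
  have hgt3 : ¬ 1 + c.b * c.m + c.NZ * c.m + c.NX * c.b + q * c.L + k ≤ c.b * c.m + c.NZ * c.m + c.NX * c.b := by omega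
  rw [assignP, h1, assign, if_neg hgt1, if_neg hgt2, if_neg hgt3]
  have hq : 1 + c.b * c.m + c.NZ * c.m + c.NX * c.b + q * c.L + k - (c.b * c.m + c.NZ * c.m + c.NX * c.b) - 1 = k + c.L * q := by
    rw [Nat.mul_comm q]; omega
  simp only [hq, Nat.add_mul_div_left _ _ hL, Nat.add_mul_mod_self_left, Nat.div_eq_of_lt hk, Nat.mod_eq_of_lt hk, zero_add]

/-- On matrix variables the full assignment is `pbit`. [folklore] -/
theorem assignP_pv {i j : ℕ} (hi : i < c.b) (hj : j < c.m) : assignP c P (c.pv i j).toNat = pbit c P (c.pv i j).toNat := by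
  rw [assignP, assign_pv c P _ hi hj, pbit]
  have h1 : (c.pv i j).toNat = 1 + i * c.m + j := rfl
  have hm : 0 < c.m := by omega
  have hq : (1 + i * c.m + j - 1) = j + c.m * i := by rw [Nat.mul_comm]; omega
  rw [h1, hq, Nat.add_mul_div_left _ _ hm, Nat.add_mul_mod_self_left, Nat.div_eq_of_lt hj, Nat.mod_eq_of_lt hj]
  simp

/-- Both lists of `lexPair c q` consist of matrix variables `pv i j` with `i < b`, `j < m`, and have equal length `≤ L`. [folklore] -/
theorem lexPair_spec (hw1 : 1 ≤ c.w) (hwm : c.w ≤ c.m) {q : ℕ} (hq : q < c.NQ) :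
    (∀ v ∈ (lexPair c q).1 ++ (lexPair c q).2, ∃ i j, i < c.b ∧ j < c.m ∧ v = c.pv i j) ∧
      (lexPair c q).2.length = (lexPair c q).1.length ∧ (lexPair c q).1.length ≤ c.L := by
  unfold lexPair
  have hNQ : c.NQ = (c.b - 1) + (c.w - 1) + (c.m - c.w - 1) := rfl
  split_ifs with h1 h2
  · refine ⟨?_, by simp, by simp [Cfg.L]⟩
    intro v hv
    simp only [List.mem_append, List.mem_map, List.mem_reverse, List.mem_range] at hv
    rcases hv with ⟨j, hj, rfl⟩ | ⟨j, hj, rfl⟩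
    · exact ⟨q, j, by omega, hj, rfl⟩
    · exact ⟨q + 1, j, by omega, hj, rfl⟩
  · refine ⟨?_, by simp, by simp [Cfg.L]⟩
    intro v hv
    simp only [List.mem_append, List.mem_map, List.mem_range] at hv
    rcases hv with ⟨i, hi, rfl⟩ | ⟨i, hi, rfl⟩
    · exact ⟨i, _, hi, by omega, rfl⟩
    · exact ⟨i, _, hi, by omega, rfl⟩
  · refine ⟨?_, by simp, by simp [Cfg.L]⟩
    intro v hv
    simp only [List.mem_append, List.mem_map, List.mem_range] at hv
    rcases hv with ⟨i, hi, rfl⟩ | ⟨i, hi, rfl⟩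
    · exact ⟨i, _, hi, by omega, rfl⟩
    · exact ⟨i, _, hi, by omega, rfl⟩

/-- **The `q`-th lex block is satisfied** (`q < NQ`) under `LexCond`. [folklore] -/
theorem satisfies_lexBlock (hw1 : 1 ≤ c.w) (hwm : c.w ≤ c.m) (hL : LexCond c P) {q : ℕ} (hq : q < c.NQ) :
    ∀ cl ∈ lexBlock c q (lexPair c q).1 (lexPair c q).2, (valOf (assignP c P)).satisfies (cl.map Sat.Literal.ofInt) := by
  obtain ⟨hvars, hlen, hlenL⟩ := lexPair_spec c hw1 hwm hq
  have hL0 : 0 < c.L := by unfold Cfg.L; omega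
  have hev1 : ∀ k, 1 ≤ c.ev q k := fun k => by
    show (1 : ℤ) ≤ ((1 + c.b * c.m + c.NZ * c.m + c.NX * c.b + q * c.L + k : ℕ) : ℤ); omega
  have hpv1 : ∀ v ∈ (lexPair c q).1 ++ (lexPair c q).2, 1 ≤ v := by
    intro v hv; obtain ⟨i, j, -, -, rfl⟩ := hvars v hv
    show (1 : ℤ) ≤ ((1 + i * c.m + j : ℕ) : ℤ); omega
  -- the β-images of the compared lists are the `lexBits`
  have hbits1 : (lexPair c q).1.map (fun v => assignP c P v.toNat) = (lexBits c P q).1 := by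
    apply List.map_congr_left; intro v hv
    obtain ⟨i, j, hi, hj, rfl⟩ := hvars v (List.mem_append.2 (Or.inl hv)); exact assignP_pv c P hi hj
  have hbits2 : (lexPair c q).2.map (fun v => assignP c P v.toNat) = (lexBits c P q).2 := by
    apply List.map_congr_left; intro v hv
    obtain ⟨i, j, hi, hj, rfl⟩ := hvars v (List.mem_append.2 (Or.inr hv)); exact assignP_pv c P hi hj
  intro cl hcl
  simp only [lexBlock, List.mem_append, List.mem_singleton] at hcl
  rcases hcl with rfl | hcl
  · -- the unit [ev q 0]: the empty prefix agrees
    refine satisfies_of_mem_true _ _ (by intro l hl; simp at hl; subst hl; have := hev1 0; omega) ⟨c.ev q 0, by simp, ?_⟩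
    have h0 : ¬ c.ev q 0 < 0 := by have := hev1 0; omega
    simp only [litVal, h0, if_false]
    rw [assignP_ev c P (k := 0) hL0]
    simp [evalAux, prefixEqB]
  · refine satisfies_lexClauses (assignP c P) _ _ _ True
      (fun v hv => hpv1 v (List.mem_append.2 (Or.inl hv))) (fun v hv => hpv1 v (List.mem_append.2 (Or.inr hv)))
      (fun v hv => by obtain ⟨k, -, rfl⟩ := List.mem_map.1 hv; exact hev1 k) hlen (by simp) ?_ ?_ ?_ cl hcl
    · intro k hk hβ
      simp only [List.length_map, List.length_range] at hk
      rw [getD_map_range _ _ hk, assignP_ev c P (by omega)] at hβ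
      refine ⟨trivial, ?_⟩
      rw [hbits1, hbits2]
      exact (prefixEqB_eq_true_iff _ _ _).1 hβ
    · intro _; rw [hbits1, hbits2]; exact hL q hq
    · rintro k hk ⟨-, hpf⟩
      simp only [List.length_map, List.length_range] at hk
      rw [getD_map_range _ _ hk, assignP_ev c P (by omega)]
      rw [hbits1, hbits2] at hpf
      exact (prefixEqB_eq_true_iff _ _ _).2 hpf

end

section Assembly
variable (c : Cfg) (P : ℕ → ℕ → Bool)

/-- **The lex family is satisfied** under `LexCond` (`1 ≤ w ≤ m`). [folklore] -/
theorem satisfies_symClauses (hw1 : 1 ≤ c.w) (hwm : c.w ≤ c.m) (hL : LexCond c P) :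
    ∀ cl ∈ symClauses c, (valOf (assignP c P)).satisfies (cl.map Sat.Literal.ofInt) := by
  intro cl hcl
  have hNQ : c.NQ = (c.b - 1) + (c.w - 1) + (c.m - c.w - 1) := rfl
  unfold symClauses at hcl
  rcases List.mem_append.1 hcl with h12 | h3
  · rcases List.mem_append.1 h12 with h1 | h2
    · -- row pairs: q = i < b − 1
      simp only [List.mem_flatMap, List.mem_range] at h1
      obtain ⟨i, hi, hmem⟩ := h1
      have hq : i < c.NQ := by omega
      have hpair : lexPair c i = ((((List.range c.m).reverse).map fun j => c.pv i j),
          (((List.range c.m).reverse).map fun j => c.pv (i + 1) j)) := by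
        simp [lexPair, hi]
      have := satisfies_lexBlock c P hw1 hwm hL hq
      rw [hpair] at this
      exact this cl hmem
    · -- S-column pairs: q = (b − 1) + t, t < w − 1
      simp only [List.mem_flatMap, List.mem_range] at h2
      obtain ⟨t, ht, hmem⟩ := h2
      have hq : c.b - 1 + t < c.NQ := by omega
      have hpair : lexPair c (c.b - 1 + t) = (((List.range c.b).map fun i => c.pv i (0 + t + 1)),
          ((List.range c.b).map fun i => c.pv i (0 + t))) := by
        have h1 : ¬ c.b - 1 + t < c.b - 1 := by omega
        have h2 : c.b - 1 + t < c.b - 1 + (c.w - 1) := by omega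
        simp [lexPair, h1, h2]
      have := satisfies_lexBlock c P hw1 hwm hL hq
      rw [hpair] at this
      exact this cl hmem
  · -- S^c-column pairs: q = (b − 1) + (w − 1) + t, t < m − w − 1
    simp only [List.mem_flatMap, List.mem_range] at h3
    obtain ⟨t, ht, hmem⟩ := h3
    have hq : c.b - 1 + (c.w - 1) + t < c.NQ := by omega
    have hpair : lexPair c (c.b - 1 + (c.w - 1) + t) = (((List.range c.b).map fun i => c.pv i (c.w + t + 1)),
        ((List.range c.b).map fun i => c.pv i (c.w + t))) := by
      have h1 : ¬ c.b - 1 + (c.w - 1) + t < c.b - 1 := by omega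
      have h2 : ¬ c.b - 1 + (c.w - 1) + t < c.b - 1 + (c.w - 1) := by omega
      have h3 : c.w + (c.b - 1 + (c.w - 1) + t - (c.b - 1) - (c.w - 1)) = c.w + t := by omega
      simp [lexPair, h1, h2, h3]
    have := satisfies_lexBlock c P hw1 hwm hL hq
    rw [hpair] at this
    exact this cl hmem

/-- **Soundness of the whole encoding**: a Boolean matrix `P` satisfying `ZCond`, `XCond` and `LexCond` (with `1 ≤ w ≤ m`) yields a
valuation satisfying every clause of `NFEnc.fmla c`. [folklore] -/
theorem satisfies_fmla_of_conds (hw1 : 1 ≤ c.w) (hwm : c.w ≤ c.m) (hZ : ZCond c P) (hX : XCond c P) (hL : LexCond c P) :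
    (valOf (assignP c P)).satisfies_fmla (NFEnc.fmla c) := by
  refine ⟨fun cl hcl => ?_⟩
  simp only [NFEnc.fmla, List.mem_map] at hcl
  obtain ⟨cl', hmem, rfl⟩ := hcl
  simp only [NFEnc.cnf, List.mem_append] at hmem
  rcases hmem with (hs | hz) | hx
  · exact satisfies_symClauses c P hw1 hwm hL cl' hs
  · exact satisfies_zClauses c P (evalAux c P) hZ cl' hz
  · exact satisfies_xClauses c P (evalAux c P) hX cl' hx

/-- **Contradiction form**: under the same hypotheses, a kernel UNSAT theorem `Sat.Fmla.proof (NFEnc.fmla c) Sat.Clause.nil` is absurd.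
[folklore] -/
theorem false_of_unsat (hw1 : 1 ≤ c.w) (hwm : c.w ≤ c.m) (hZ : ZCond c P) (hX : XCond c P) (hL : LexCond c P)
    (hunsat : Sat.Fmla.proof (NFEnc.fmla c) Sat.Clause.nil) : False :=
  hunsat (valOf (assignP c P)) (satisfies_fmla_of_conds c P hw1 hwm hZ hX hL)

/-- **Contradiction form with cube units**: if moreover every unit literal in `units` (matrix literals `±pv i j`, `i < b`, `j < m`) is true
under `P`, a kernel UNSAT theorem for `cnf c ++ units` is absurd. [folklore] -/
theorem false_of_unsat_units (hw1 : 1 ≤ c.w) (hwm : c.w ≤ c.m) (hZ : ZCond c P) (hX : XCond c P) (hL : LexCond c P)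
    (units : List (List ℤ)) (hunits : ∀ u ∈ units, ∃ l ∈ u, l ≠ 0 ∧ (∀ l' ∈ u, l' ≠ 0) ∧ litVal (assignP c P) l = true)
    (hunsat : Sat.Fmla.proof (List.map (fun cl : List ℤ => cl.map Sat.Literal.ofInt) (NFEnc.cnf c ++ units)) Sat.Clause.nil) :
    False := by
  refine hunsat (valOf (assignP c P)) ⟨fun cl hcl => ?_⟩
  simp only [List.map_append, List.mem_append, List.mem_map] at hcl
  rcases hcl with ⟨cl', hmem, rfl⟩ | ⟨u, hu, rfl⟩
  · exact (satisfies_fmla_of_conds c P hw1 hwm hZ hX hL).prop _ (by simp only [NFEnc.fmla, List.mem_map]; exact ⟨cl', hmem, rfl⟩)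
  · obtain ⟨l, hl, -, hnz, htrue⟩ := hunits u hu
    exact satisfies_of_mem_true _ u hnz ⟨l, hl, htrue⟩

end Assembly

end Summit.Ventures.QEC.Census.CSSNormalFormSAT
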